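import Literature.MathematicalPhysics.QuantumLattice.SourcedHubbardBlockPartitionFunction
import Literature.MathematicalPhysics.QuantumLattice.FinDimSpectrumProofs
import HarnessLib

/-!
# Graded locality and ground energies: additivity over disjoint regions, the regional fermion
# parity, and the parity-superselection cut (Ruelle's cut for lattice fermions, any region)

Topic `MathematicalPhysics/QuantumLattice` (finite-volume bookkeeping for lattice fermions; written for
the cell `hubbard-cq`, negation lens N-W0-LOCAL / census (13): the site-local version of the sourced
ε-lift barrier `Literature.Barriers.HubbardSuperconductivity.SourcedResponseEpsilonLift`, whose lattice
half needs `E₀(H_Λ) ≤ E₀(H_A) + E₀(H_{Λ∖A})` for an ARBITRARY region `A` of the torus, not only for a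
cut of the linearly ordered orbital set into a lower and an upper block as in the tree's
`ThermodynamicLimit.re_dotProduct_hamiltonian_blockProd_le`). Everything is at the level of the
Jordan–Wigner matrix algebra `Matrix (Finset ι) (Finset ι) ℂ` of a finite linearly ordered orbital set
`ι` and its CAR subalgebras `carSubalgebra S` / `carEvenSubalgebra S` (`FermionTraceFactorization`):

* **Additivity of ground energies over graded-commuting regions**
  (`groundEnergy_add_of_mem_carEvenSubalgebra`): for Hermitian `A ∈ 𝔄₊(S₁)`, `B ∈ 𝔄(S₂)` with
  `S₁ ∩ S₂ = ∅`, `E₀(A + B) = E₀(A) + E₀(B)`. Proof WITHOUT product states: the tree's exact separability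
  of the partition function `log Z_β(A+B) + |ι| log 2 = log Z_β(A) + log Z_β(B)`
  (`log_partitionFn_add_of_mem'`) and the two-sided bound `−βE₀ ≤ log Z_β ≤ |ι| log 2 − βE₀`, then
  `β → ∞`.
* **The regional fermion parity** `regionParityOp S = (-1)^{N_S}` (the diagonal matrix
  `|s⟩ ↦ (-1)^{#(s ∩ S)} |s⟩`; `S = univ` is the tree's `parityOp`): an Hermitian involution which
  ANTICOMMUTES with `c_i, c†_i` for `i ∈ S` and COMMUTES with them for `i ∉ S`
  (`regionParityOp_mul_letterOp_of_mem / _of_not_mem`), hence commutes with the even algebra of any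
  `T ⊆ S` and with the whole algebra of any `T` disjoint from `S`
  (`commute_regionParityOp_of_mem_carEvenSubalgebra`, `commute_regionParityOp_of_mem_carSubalgebra`), and
  flips the sign of every STRADDLING pair `c^♯_i c^♯_j`, `i ∈ S ∌ j`
  (`regionParityOp_mul_letterOp_mul_letterOp_mul_regionParityOp`).
* **The parity-superselection cut** (`groundEnergy_add_le_of_grading`, model-free): if a Hermitian
  involution `P` commutes with the Hermitian `M` and `P W P = −W`, then `E₀(M + W) ≤ E₀(M)` — the ground
  space of `M` is `P`-invariant, so it contains a `P`-eigenvector, in which `⟨W⟩ = 0`. Combined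
  (`groundEnergy_add_add_le_of_straddling`): for Hermitian `A ∈ 𝔄₊(S₁)`, `B ∈ 𝔄(S₂)` (`S₁ ∩ S₂ = ∅`) and
  any Hermitian `W` odd under `(-1)^{N_{S₁}}` (all hopping and pair terms straddling the cut),
  `E₀(A + B + W) ≤ E₀(A) + E₀(B)`. This is Ruelle's sub-box variational principle for lattice fermions
  over an arbitrary region, with the Jordan–Wigner strings handled by superselection instead of by an
  explicit graded tensor product.

References: D. Ruelle, *Statistical Mechanics: Rigorous Results* (1969), §2.2–2.3 (interactions,
boundary terms, sub-box variational principle) [cite: Ruelle1969, §2.2]; O. Bratteli, D. W. Robinson,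
*Operator Algebras and QSM II* (1997), §5.2.2 (CAR algebra of a direct sum as a graded tensor product;
even elements of disjoint regions commute) [cite: BratteliRobinsonII1997, §5.2.2]; H. Tasaki, *Physics
and Mathematics of Quantum Many-Body Systems* (2020), §2.1 (variational principle), §9.2 (fermion parity)
[cite: Tasaki2020, §9.2]. All statements are [folklore].

Tree search (`lean search`): `parityOp` (global parity only; `FermionOperators`), `carEvenSubalgebra`,
`commute_of_mem_carEvenSubalgebra`, `log_partitionFn_add_of_mem'` (REUSED); no regional parity, no
ground-energy additivity over regions, no cut for interleaved regions (`re_dotProduct_hamiltonian_blockProd_le`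
needs block 1 below block 2; `ClusterProduct.prodFamily` needs equal-shape clusters).
-/

noncomputable section

open Matrix Finset
open scoped ComplexOrder

namespace Literature.MathematicalPhysics.QuantumLattice

/-! ### Two-sided bounds `−βE₀ ≤ log Z_β ≤ log D − βE₀` and the `β → ∞` bookkeeping -/

section PartitionBounds

variable {n : Type*} [Fintype n] [DecidableEq n]

/-- `e^{-βE₀} ≤ Re Z_β` (keep the ground-state term of `Z = Σ e^{-βλᵢ}`). [folklore] -/
private theorem exp_neg_le_partitionFn_re [Nonempty n] {H : Matrix n n ℂ} (hH : H.IsHermitian) (β : ℝ) :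
    Real.exp (-(β * H.groundEnergy)) ≤ (H.partitionFn β).re := by
  rw [partitionFn_eq_sum_exp β hH, Complex.re_sum, groundEnergy_eq_iInf_eigenvalues_holds hH]
  obtain ⟨i₀, hi₀⟩ := exists_eq_ciInf_of_finite (f := hH.eigenvalues)
  rw [← hi₀]
  have h := Finset.single_le_sum (f := fun i => Real.exp (-β * hH.eigenvalues i))
    (fun i _ => (Real.exp_pos _).le) (Finset.mem_univ i₀)
  simp only [Complex.ofReal_re]
  simpa [neg_mul] using h

/-- `Re Z_β ≤ D e^{-βE₀}` for `β ≥ 0`, `D` the dimension. [folklore] -/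
private theorem partitionFn_re_le_card_mul_exp {H : Matrix n n ℂ} (hH : H.IsHermitian) {β : ℝ} (hβ : 0 ≤ β) :
    (H.partitionFn β).re ≤ Fintype.card n * Real.exp (-(β * H.groundEnergy)) := by
  rw [partitionFn_eq_sum_exp β hH, Complex.re_sum]
  simp only [Complex.ofReal_re]
  calc ∑ i, Real.exp (-β * hH.eigenvalues i) ≤ ∑ _i : n, Real.exp (-(β * H.groundEnergy)) := by
        refine Finset.sum_le_sum fun i _ => Real.exp_le_exp.2 ?_
        have := groundEnergy_le_eigenvalues hH i
        nlinarith
    _ = Fintype.card n * Real.exp (-(β * H.groundEnergy)) := by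
        rw [Finset.sum_const, Finset.card_univ, nsmul_eq_mul]

/-- `−βE₀ ≤ log Re Z_β`. [folklore] -/
private theorem neg_mul_groundEnergy_le_log [Nonempty n] {H : Matrix n n ℂ} (hH : H.IsHermitian) (β : ℝ) :
    -(β * H.groundEnergy) ≤ Real.log (H.partitionFn β).re := by
  have h := Real.log_le_log (Real.exp_pos _) (exp_neg_le_partitionFn_re hH β)
  rwa [Real.log_exp] at h

/-- `log Re Z_β ≤ log D − βE₀` for `β ≥ 0`. [folklore] -/
private theorem log_partitionFn_re_le [Nonempty n] {H : Matrix n n ℂ} (hH : H.IsHermitian) {β : ℝ}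
    (hβ : 0 ≤ β) :
    Real.log (H.partitionFn β).re ≤ Real.log (Fintype.card n) - β * H.groundEnergy := by
  have hD : (0 : ℝ) < Fintype.card n := by exact_mod_cast Fintype.card_pos
  have hZ : 0 < (H.partitionFn β).re := lt_of_lt_of_le (Real.exp_pos _) (exp_neg_le_partitionFn_re hH β)
  have h := Real.log_le_log hZ (partitionFn_re_le_card_mul_exp hH hβ)
  rw [Real.log_mul hD.ne' (Real.exp_pos _).ne', Real.log_exp] at h
  linarith

/-- If `βx ≤ K` for every `β > 0` then `x ≤ 0`. [folklore] -/
private theorem gradedCut_nonpos_of_forall_pos_mul_le {x K : ℝ} (h : ∀ β : ℝ, 0 < β → β * x ≤ K) : x ≤ 0 := by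
  by_contra hx
  push Not at hx
  have hβ : 0 < (|K| + 1) / x := div_pos (by positivity) hx
  have h1 := h _ hβ
  rw [div_mul_cancel₀ _ hx.ne'] at h1
  linarith [le_abs_self K]

end PartitionBounds

/-! ### Additivity of ground energies over graded-commuting regions -/

section Additivity

variable {ι : Type*} [LinearOrder ι] [Fintype ι]

/-- **Additivity of ground energies over disjoint regions.** For Hermitian `A` in the even CAR
subalgebra of `S₁` and Hermitian `B` in the CAR subalgebra of a disjoint `S₂`,
`E₀(A + B) = E₀(A) + E₀(B)`: the Fock space is the graded tensor product of the regional Fock spaces and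
the spectrum of `A + B` is the sum set. Proof via the exact separability of the partition function
(`log_partitionFn_add_of_mem'`) and `−βE₀ ≤ log Z_β ≤ |ι| log 2 − βE₀`, `β → ∞`.
[cite: BratteliRobinsonII1997, §5.2.2] -/
theorem groundEnergy_add_of_mem_carEvenSubalgebra {S₁ S₂ : Finset ι} {A B : Matrix (Finset ι) (Finset ι) ℂ}
    (hA : A ∈ carEvenSubalgebra S₁) (hB : B ∈ carSubalgebra S₂) (hS : Disjoint S₁ S₂)
    (hAh : A.IsHermitian) (hBh : B.IsHermitian) :
    (A + B).groundEnergy = A.groundEnergy + B.groundEnergy := by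
  have hABh : (A + B).IsHermitian := hAh.add hBh
  set K : ℝ := Fintype.card ι * Real.log 2 with hK
  have hcard : Real.log (Fintype.card (Finset ι)) = K := by
    rw [Fintype.card_finset, Nat.cast_pow, Nat.cast_ofNat, Real.log_pow, hK]
  -- the identity at every `β`
  have hid : ∀ β : ℝ, Real.log ((A + B).partitionFn β).re + K =
      Real.log (A.partitionFn β).re + Real.log (B.partitionFn β).re := fun β =>
    log_partitionFn_add_of_mem' hA hB hS hAh hBh β
  apply le_antisymm
  · -- `E₀(A+B) ≤ E₀(A) + E₀(B)`
    have h : ∀ β : ℝ, 0 < β →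
        β * ((A + B).groundEnergy - A.groundEnergy - B.groundEnergy) ≤ 2 * K := by
      intro β hβ
      have h1 := neg_mul_groundEnergy_le_log hAh β
      have h2 := neg_mul_groundEnergy_le_log hBh β
      have h3 := log_partitionFn_re_le hABh hβ.le
      rw [hcard] at h3
      have h4 := hid β
      nlinarith
    have := gradedCut_nonpos_of_forall_pos_mul_le h
    linarith
  · -- `E₀(A) + E₀(B) ≤ E₀(A+B)`
    have h : ∀ β : ℝ, 0 < β →
        β * (A.groundEnergy + B.groundEnergy - (A + B).groundEnergy) ≤ K := by
      intro β hβ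
      have h1 := neg_mul_groundEnergy_le_log hABh β
      have h2 := log_partitionFn_re_le hAh hβ.le
      have h3 := log_partitionFn_re_le hBh hβ.le
      rw [hcard] at h2 h3
      have h4 := hid β
      nlinarith
    have := gradedCut_nonpos_of_forall_pos_mul_le h
    linarith

/-- Symmetric form: Hermitian `A ∈ 𝔄(S₁)`, `B ∈ 𝔄₊(S₂)`, `S₁ ∩ S₂ = ∅` ⇒ `E₀(A + B) = E₀(A) + E₀(B)`.
[cite: BratteliRobinsonII1997, §5.2.2] -/
theorem groundEnergy_add_of_mem_carEvenSubalgebra' {S₁ S₂ : Finset ι} {A B : Matrix (Finset ι) (Finset ι) ℂ}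
    (hA : A ∈ carSubalgebra S₁) (hB : B ∈ carEvenSubalgebra S₂) (hS : Disjoint S₁ S₂)
    (hAh : A.IsHermitian) (hBh : B.IsHermitian) :
    (A + B).groundEnergy = A.groundEnergy + B.groundEnergy := by
  rw [add_comm A B, groundEnergy_add_of_mem_carEvenSubalgebra hB hA hS.symm hBh hAh, add_comm]

end Additivity

/-! ### The regional fermion parity `(-1)^{N_S}` -/

section RegionParity

variable {ι : Type*} [LinearOrder ι]

/-- **The regional fermion parity** `(-1)^{N_S}` of the orbital set `S`: the diagonal matrix
`|s⟩ ↦ (-1)^{#(s ∩ S)} |s⟩` in the occupation basis (`= ∏_{i ∈ S} (1 − 2 n_i)`; for `S = univ` the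
tree's `parityOp`). It implements the `ℤ₂`-grading of the CAR subalgebra of `S` and is the
superselection charge that kills every term straddling the boundary of `S` in a parity-definite state.
Tasaki (2020) §9.2; Bratteli–Robinson II §5.2.2. [cite: Tasaki2020, §9.2] -/
def regionParityOp (S : Finset ι) : Matrix (Finset ι) (Finset ι) ℂ :=
  diagonal fun s => (-1) ^ (s ∩ S).card

variable (S : Finset ι)

/-- The entries of `(-1)^{N_S}` (definitional). [cite: Tasaki2020, §9.2] -/
theorem regionParityOp_apply (s t : Finset ι) :
    regionParityOp S s t = if s = t then (-1 : ℂ) ^ (s ∩ S).card else 0 := by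
  rw [regionParityOp, diagonal_apply]

/-- `(-1)^{N_∅} = 1`. [cite: Tasaki2020, §9.2] -/
theorem regionParityOp_empty : regionParityOp (∅ : Finset ι) = 1 := by
  unfold regionParityOp
  rw [← diagonal_one]
  congr 1
  funext s
  rw [Finset.inter_empty, Finset.card_empty, pow_zero]

/-- `(-1)^{N_S}` is self-adjoint. [cite: Tasaki2020, §9.2] -/
theorem regionParityOp_conjTranspose : (regionParityOp S)ᴴ = regionParityOp S := by
  rw [regionParityOp, diagonal_conjTranspose]
  congr 1
  funext s
  simp

/-- `(-1)^{N_S}` is Hermitian. [cite: Tasaki2020, §9.2] -/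
theorem regionParityOp_isHermitian : (regionParityOp S).IsHermitian :=
  regionParityOp_conjTranspose S

variable [Fintype ι]

/-- `(-1)^{N_univ}` is the global fermion parity `parityOp`. [cite: Tasaki2020, §9.2] -/
theorem regionParityOp_univ : regionParityOp (Finset.univ : Finset ι) = parityOp := by
  unfold regionParityOp parityOp
  congr 1
  funext s
  rw [Finset.inter_univ]

/-- `(-1)^{N_S}` is an involution. [cite: Tasaki2020, §9.2] -/
theorem regionParityOp_mul_self : regionParityOp S * regionParityOp S = 1 := by
  rw [regionParityOp, diagonal_mul_diagonal, ← diagonal_one]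
  congr 1
  funext s
  rw [← mul_pow]
  norm_num

/-- **`c_i` is odd under `(-1)^{N_S}` for `i ∈ S`**: `(-1)^{N_S} c_i = −c_i (-1)^{N_S}`.
[cite: Tasaki2020, §9.2] -/
theorem regionParityOp_mul_annihilation_of_mem {i : ι} (hi : i ∈ S) :
    regionParityOp S * annihilation i = -(annihilation i * regionParityOp S) := by
  ext s t
  simp only [regionParityOp, diagonal_mul, mul_diagonal, Matrix.neg_apply, annihilation_apply]
  split_ifs with h
  · rw [h.2, Finset.insert_inter_of_mem hi,
      Finset.card_insert_of_notMem (fun h' => h.1 (Finset.mem_inter.1 h').1), pow_succ]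
    ring
  · simp

/-- **`c_i` is even under `(-1)^{N_S}` for `i ∉ S`**: `(-1)^{N_S} c_i = c_i (-1)^{N_S}`.
[cite: Tasaki2020, §9.2] -/
theorem regionParityOp_mul_annihilation_of_not_mem {i : ι} (hi : i ∉ S) :
    regionParityOp S * annihilation i = annihilation i * regionParityOp S := by
  ext s t
  simp only [regionParityOp, diagonal_mul, mul_diagonal, annihilation_apply]
  split_ifs with h
  · rw [h.2, Finset.insert_inter_of_notMem hi]
    ring
  · simp

/-- `(-1)^{N_S} c†_i = −c†_i (-1)^{N_S}` for `i ∈ S`. [cite: Tasaki2020, §9.2] -/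
theorem regionParityOp_mul_creation_of_mem {i : ι} (hi : i ∈ S) :
    regionParityOp S * creation i = -(creation i * regionParityOp S) := by
  have h := congrArg conjTranspose (regionParityOp_mul_annihilation_of_mem S hi)
  rw [conjTranspose_mul, conjTranspose_neg, conjTranspose_mul, regionParityOp_conjTranspose] at h
  rw [creation, h, neg_neg]

/-- `(-1)^{N_S} c†_i = c†_i (-1)^{N_S}` for `i ∉ S`. [cite: Tasaki2020, §9.2] -/
theorem regionParityOp_mul_creation_of_not_mem {i : ι} (hi : i ∉ S) :
    regionParityOp S * creation i = creation i * regionParityOp S := by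
  have h := congrArg conjTranspose (regionParityOp_mul_annihilation_of_not_mem S hi)
  rw [conjTranspose_mul, conjTranspose_mul, regionParityOp_conjTranspose] at h
  rw [creation, h]

/-- A Jordan–Wigner letter `c_i / c†_i` with `i ∈ S` anticommutes with `(-1)^{N_S}`.
[cite: Tasaki2020, §9.2] -/
theorem regionParityOp_mul_letterOp_of_mem {l : JWLetter ι} (hl : l.1 ∈ S) :
    regionParityOp S * letterOp l = -(letterOp l * regionParityOp S) := by
  obtain ⟨i, b⟩ := l
  cases b
  · exact regionParityOp_mul_annihilation_of_mem S hl
  · exact regionParityOp_mul_creation_of_mem S hl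

/-- A Jordan–Wigner letter `c_i / c†_i` with `i ∉ S` commutes with `(-1)^{N_S}`.
[cite: Tasaki2020, §9.2] -/
theorem regionParityOp_mul_letterOp_of_not_mem {l : JWLetter ι} (hl : l.1 ∉ S) :
    regionParityOp S * letterOp l = letterOp l * regionParityOp S := by
  obtain ⟨i, b⟩ := l
  cases b
  · exact regionParityOp_mul_annihilation_of_not_mem S hl
  · exact regionParityOp_mul_creation_of_not_mem S hl

/-- **Straddling pairs are odd**: for letters `l` at an orbital of `S` and `l'` at an orbital
outside `S`, `(-1)^{N_S} (l l') (-1)^{N_S} = −(l l')` (every hopping `c†_i c_j` and every pair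
`c_i c_j` across the boundary of `S`). [cite: BratteliRobinsonII1997, §5.2.2] -/
theorem regionParityOp_mul_letterOp_mul_letterOp_mul_regionParityOp {l l' : JWLetter ι} (hl : l.1 ∈ S)
    (hl' : l'.1 ∉ S) :
    regionParityOp S * (letterOp l * letterOp l') * regionParityOp S = -(letterOp l * letterOp l') := by
  have h1 := regionParityOp_mul_letterOp_of_mem S hl
  have h2 := regionParityOp_mul_letterOp_of_not_mem S hl'
  calc regionParityOp S * (letterOp l * letterOp l') * regionParityOp S
        = (regionParityOp S * letterOp l) * letterOp l' * regionParityOp S := by simp only [Matrix.mul_assoc]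
    _ = -(letterOp l * (regionParityOp S * letterOp l') * regionParityOp S) := by
          rw [h1]; simp only [neg_mul, Matrix.mul_assoc]
    _ = -(letterOp l * letterOp l' * (regionParityOp S * regionParityOp S)) := by
          rw [h2]; simp only [Matrix.mul_assoc]
    _ = -(letterOp l * letterOp l') := by rw [regionParityOp_mul_self, Matrix.mul_one]

/-- The same with the outside letter first: `(-1)^{N_S} (l' l) (-1)^{N_S} = −(l' l)`.
[cite: BratteliRobinsonII1997, §5.2.2] -/
theorem regionParityOp_mul_letterOp_mul_letterOp_mul_regionParityOp' {l l' : JWLetter ι} (hl : l.1 ∈ S)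
    (hl' : l'.1 ∉ S) :
    regionParityOp S * (letterOp l' * letterOp l) * regionParityOp S = -(letterOp l' * letterOp l) := by
  have h1 := regionParityOp_mul_letterOp_of_mem S hl
  have h2 := regionParityOp_mul_letterOp_of_not_mem S hl'
  calc regionParityOp S * (letterOp l' * letterOp l) * regionParityOp S
        = (regionParityOp S * letterOp l') * letterOp l * regionParityOp S := by simp only [Matrix.mul_assoc]
    _ = letterOp l' * (regionParityOp S * letterOp l) * regionParityOp S := by
          rw [h2]; simp only [Matrix.mul_assoc]
    _ = -(letterOp l' * letterOp l * (regionParityOp S * regionParityOp S)) := by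
          rw [h1]; simp only [neg_mul, mul_neg, Matrix.mul_assoc]
    _ = -(letterOp l' * letterOp l) := by rw [regionParityOp_mul_self, Matrix.mul_one]

/-- **`(-1)^{N_S}` commutes with the even CAR subalgebra of every `T ⊆ S`** (a product of two letters
of `T` picks up two signs). [cite: BratteliRobinsonII1997, §5.2.2] -/
theorem commute_regionParityOp_of_mem_carEvenSubalgebra {T : Finset ι} (hTS : T ⊆ S)
    {a : Matrix (Finset ι) (Finset ι) ℂ} (ha : a ∈ carEvenSubalgebra T) : Commute (regionParityOp S) a := by
  have hle : carEvenSubalgebra T ≤ Subalgebra.centralizer ℂ {regionParityOp S} := by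
    refine Algebra.adjoin_le ?_
    rintro _ ⟨l, l', hl, hl', rfl⟩
    rw [SetLike.mem_coe, Subalgebra.mem_centralizer_iff]
    intro g hg
    rw [Set.mem_singleton_iff] at hg
    subst hg
    show regionParityOp S * (letterOp l * letterOp l') = letterOp l * letterOp l' * regionParityOp S
    rw [← Matrix.mul_assoc, regionParityOp_mul_letterOp_of_mem S (hTS hl), neg_mul, Matrix.mul_assoc,
      regionParityOp_mul_letterOp_of_mem S (hTS hl'), mul_neg, neg_neg, Matrix.mul_assoc]
  exact (Subalgebra.mem_centralizer_iff ℂ).1 (hle ha) _ (Set.mem_singleton _)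

/-- **`(-1)^{N_S}` commutes with the whole CAR subalgebra of every `T` disjoint from `S`.**
[cite: BratteliRobinsonII1997, §5.2.2] -/
theorem commute_regionParityOp_of_mem_carSubalgebra {T : Finset ι} (hTS : Disjoint S T)
    {a : Matrix (Finset ι) (Finset ι) ℂ} (ha : a ∈ carSubalgebra T) : Commute (regionParityOp S) a := by
  have hle : carSubalgebra T ≤ Subalgebra.centralizer ℂ {regionParityOp S} := by
    refine Algebra.adjoin_le ?_
    rintro _ ⟨l, hl, rfl⟩
    rw [SetLike.mem_coe, Subalgebra.mem_centralizer_iff]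
    intro g hg
    rw [Set.mem_singleton_iff] at hg
    subst hg
    exact regionParityOp_mul_letterOp_of_not_mem S (fun h => Finset.disjoint_left.1 hTS h hl)
  exact (Subalgebra.mem_centralizer_iff ℂ).1 (hle ha) _ (Set.mem_singleton _)

/-! #### Closure properties of `P`-odd operators (`P X P = −X`) -/

variable {S}

/-- Sums of `(-1)^{N_S}`-odd operators are odd (the odd part of the `ℤ₂`-grading is a subspace). [cite: BratteliRobinsonII1997, §5.2.2] -/
theorem regionParityOp_odd_add {X Y : Matrix (Finset ι) (Finset ι) ℂ}
    (hX : regionParityOp S * X * regionParityOp S = -X) (hY : regionParityOp S * Y * regionParityOp S = -Y) :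
    regionParityOp S * (X + Y) * regionParityOp S = -(X + Y) := by
  rw [Matrix.mul_add, Matrix.add_mul, hX, hY, neg_add]

/-- Scalar multiples of `(-1)^{N_S}`-odd operators are odd. [cite: BratteliRobinsonII1997, §5.2.2] -/
theorem regionParityOp_odd_smul {X : Matrix (Finset ι) (Finset ι) ℂ} (c : ℂ)
    (hX : regionParityOp S * X * regionParityOp S = -X) :
    regionParityOp S * (c • X) * regionParityOp S = -(c • X) := by
  rw [Matrix.mul_smul, Matrix.smul_mul, hX, smul_neg]

/-- Negatives of `(-1)^{N_S}`-odd operators are odd. [cite: BratteliRobinsonII1997, §5.2.2] -/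
theorem regionParityOp_odd_neg {X : Matrix (Finset ι) (Finset ι) ℂ}
    (hX : regionParityOp S * X * regionParityOp S = -X) :
    regionParityOp S * (-X) * regionParityOp S = -(-X) := by
  rw [Matrix.mul_neg, Matrix.neg_mul, hX]

/-- Differences of `(-1)^{N_S}`-odd operators are odd. [cite: BratteliRobinsonII1997, §5.2.2] -/
theorem regionParityOp_odd_sub {X Y : Matrix (Finset ι) (Finset ι) ℂ}
    (hX : regionParityOp S * X * regionParityOp S = -X) (hY : regionParityOp S * Y * regionParityOp S = -Y) :
    regionParityOp S * (X - Y) * regionParityOp S = -(X - Y) := by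
  rw [sub_eq_add_neg, regionParityOp_odd_add hX (regionParityOp_odd_neg hY), ← sub_eq_add_neg]

/-- Finite sums of `(-1)^{N_S}`-odd operators are odd. [cite: BratteliRobinsonII1997, §5.2.2] -/
theorem regionParityOp_odd_sum {α : Type*} (s : Finset α) {X : α → Matrix (Finset ι) (Finset ι) ℂ}
    (hX : ∀ a ∈ s, regionParityOp S * X a * regionParityOp S = -X a) :
    regionParityOp S * (∑ a ∈ s, X a) * regionParityOp S = -∑ a ∈ s, X a := by
  rw [Finset.mul_sum, Finset.sum_mul, ← Finset.sum_neg_distrib]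
  exact Finset.sum_congr rfl hX

/-- Adjoints of `(-1)^{N_S}`-odd operators are odd (the grading is a `*`-grading). [cite: BratteliRobinsonII1997, §5.2.2] -/
theorem regionParityOp_odd_conjTranspose {X : Matrix (Finset ι) (Finset ι) ℂ}
    (hX : regionParityOp S * X * regionParityOp S = -X) :
    regionParityOp S * Xᴴ * regionParityOp S = -Xᴴ := by
  have h := congrArg conjTranspose hX
  rw [conjTranspose_mul, conjTranspose_mul, conjTranspose_neg, regionParityOp_conjTranspose,
    ← Matrix.mul_assoc] at h
  exact h

/-- The zero operator is odd. [cite: BratteliRobinsonII1997, §5.2.2] -/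
theorem regionParityOp_odd_zero : regionParityOp S * (0 : Matrix (Finset ι) (Finset ι) ℂ) * regionParityOp S = -0 := by
  rw [Matrix.mul_zero, Matrix.zero_mul, neg_zero]

end RegionParity

/-! ### The parity-superselection cut -/

section Cut

variable {n : Type*} [Fintype n] [DecidableEq n]

omit [DecidableEq n] in
/-- In a `P`-eigenvector (`P φ = ε φ`, `|ε| = 1`) every `P`-odd observable has zero expectation.
[folklore] -/
private theorem dotProduct_mulVec_eq_zero_of_odd {W P : Matrix n n ℂ} (hPh : Pᴴ = P) (hPW : P * W * P = -W)
    {φ : n → ℂ} {ε : ℂ} (hε : ε * star ε = 1) (hφ : P *ᵥ φ = ε • φ) :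
    star φ ⬝ᵥ (W *ᵥ φ) = 0 := by
  have hW : W = -(P * W * P) := by rw [hPW, neg_neg]
  have h1 : star φ ⬝ᵥ (W *ᵥ φ) = -(ε * star ε) * (star φ ⬝ᵥ (W *ᵥ φ)) := by
    conv_lhs => rw [hW]
    rw [Matrix.neg_mulVec, dotProduct_neg, ← mulVec_mulVec, ← mulVec_mulVec, hφ, mulVec_smul,
      mulVec_smul, dotProduct_smul, dotProduct_mulVec, ← conjTranspose_conjTranspose P, ← star_mulVec,
      hPh, hφ, star_smul, smul_dotProduct, smul_eq_mul, smul_eq_mul]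
    ring
  rw [hε] at h1
  have h2 : (2 : ℂ) * (star φ ⬝ᵥ (W *ᵥ φ)) = 0 := by linear_combination h1
  simpa using h2

omit [DecidableEq n] in
/-- A nonzero vector of squared norm `‖v‖²` rescales to a unit vector. [folklore] -/
private theorem exists_unit_smul {v : n → ℂ} (hv : v ≠ 0) : ∃ c : ℂ, star (c • v) ⬝ᵥ (c • v) = 1 := by
  have hpos : 0 < ‖(WithLp.toLp 2 v : EuclideanSpace ℂ n)‖ := by
    rw [norm_pos_iff]
    intro h
    exact hv (by simpa using congrArg WithLp.ofLp h)
  refine ⟨((‖(WithLp.toLp 2 v : EuclideanSpace ℂ n)‖ : ℂ))⁻¹, ?_⟩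
  have h1 : inner ℂ (WithLp.toLp 2 v : EuclideanSpace ℂ n) (WithLp.toLp 2 v) = star v ⬝ᵥ v := by
    rw [EuclideanSpace.inner_eq_star_dotProduct, dotProduct_comm]
  have hvv : star v ⬝ᵥ v = ((‖(WithLp.toLp 2 v : EuclideanSpace ℂ n)‖ : ℂ)) ^ 2 := by
    rw [← h1, inner_self_eq_norm_sq_to_K]
    rfl
  rw [star_smul, smul_dotProduct, dotProduct_smul, hvv, smul_eq_mul, smul_eq_mul]
  have hc0 : ((‖(WithLp.toLp 2 v : EuclideanSpace ℂ n)‖ : ℂ)) ≠ 0 := by exact_mod_cast hpos.ne'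
  simp only [Complex.star_def, map_inv₀, Complex.conj_ofReal]
  field_simp

/-- **The parity-superselection cut.** Let `P` be a Hermitian involution (`P² = 1`) commuting with
the Hermitian `M`, and let the Hermitian `W` be `P`-odd (`P W P = −W`). Then `E₀(M + W) ≤ E₀(M)`: the
ground space of `M` is `P`-invariant, so it contains a `P`-eigenvector `φ` (`φ = ψ ± Pψ`), and
`⟨φ, W φ⟩ = ⟨Pφ, W Pφ⟩ = −⟨φ, W φ⟩ = 0`, so `φ` is a trial state for `M + W` with energy `E₀(M)`.
(Superselection form of Ruelle's sub-box variational principle.) [cite: Ruelle1969, §2.2] -/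
theorem groundEnergy_add_le_of_grading [Nonempty n] {M W P : Matrix n n ℂ} (hM : M.IsHermitian)
    (hW : W.IsHermitian) (hPP : P * P = 1) (hPh : Pᴴ = P) (hPM : Commute P M) (hPW : P * W * P = -W) :
    (M + W).groundEnergy ≤ M.groundEnergy := by
  obtain ⟨ψ, hψ, hψ0⟩ := (Submodule.ne_bot_iff _).1 (groundSpace_ne_bot_holds hM)
  -- `P` preserves the ground space of `M`
  have hPψ : P *ᵥ ψ ∈ M.groundSpace := by
    rw [mem_groundSpace_iff] at hψ ⊢
    rw [mulVec_mulVec, ← hPM.eq, ← mulVec_mulVec, hψ, mulVec_smul]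
  -- one of `ψ ± Pψ` is a nonzero `P`-eigenvector in the ground space
  have key : ∃ φ : n → ℂ, φ ∈ M.groundSpace ∧ φ ≠ 0 ∧ ∃ ε : ℂ, ε * star ε = 1 ∧ P *ᵥ φ = ε • φ := by
    by_cases hplus : ψ + P *ᵥ ψ = 0
    · refine ⟨ψ - P *ᵥ ψ, Submodule.sub_mem _ hψ hPψ, ?_, -1, by simp, ?_⟩
      · intro hminus
        apply hψ0
        have h2 : (2 : ℂ) • ψ = 0 := by
          rw [two_smul]
          have := congrArg₂ (· + ·) hplus hminus
          simp only [add_zero] at this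
          rw [← this]
          abel
        exact (smul_eq_zero.1 h2).resolve_left two_ne_zero
      · rw [mulVec_sub, mulVec_mulVec, hPP, one_mulVec, neg_one_smul, neg_sub]
    · refine ⟨ψ + P *ᵥ ψ, Submodule.add_mem _ hψ hPψ, hplus, 1, by simp, ?_⟩
      rw [mulVec_add, mulVec_mulVec, hPP, one_mulVec, one_smul, add_comm]
  obtain ⟨φ, hφ, hφ0, ε, hε, hPφ⟩ := key
  obtain ⟨c, hc⟩ := exists_unit_smul hφ0
  have hcφ : c • φ ∈ M.groundSpace := Submodule.smul_mem _ c hφ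
  have hPcφ : P *ᵥ (c • φ) = ε • (c • φ) := by rw [mulVec_smul, hPφ, smul_comm]
  have hWz : star (c • φ) ⬝ᵥ (W *ᵥ (c • φ)) = 0 := dotProduct_mulVec_eq_zero_of_odd hPh hPW hε hPcφ
  have hray := groundEnergy_le_rayleigh_holds (hM.add hW) (c • φ) hc
  rw [add_mulVec, dotProduct_add, hWz, add_zero, (rayleigh_eq_groundEnergy_iff_holds hM (c • φ) hc).2 hcφ]
    at hray
  exact hray

/-- Two-sided form: under the same hypotheses also `E₀(M − W) ≤ E₀(M)`. [cite: Ruelle1969, §2.2] -/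
theorem groundEnergy_sub_le_of_grading [Nonempty n] {M W P : Matrix n n ℂ} (hM : M.IsHermitian)
    (hW : W.IsHermitian) (hPP : P * P = 1) (hPh : Pᴴ = P) (hPM : Commute P M) (hPW : P * W * P = -W) :
    (M - W).groundEnergy ≤ M.groundEnergy := by
  rw [sub_eq_add_neg]
  exact groundEnergy_add_le_of_grading hM hW.neg hPP hPh hPM (by rw [Matrix.mul_neg, Matrix.neg_mul, hPW])

end Cut

/-! ### Ruelle's cut for lattice fermions over an arbitrary region -/

section FermionCut

variable {ι : Type*} [LinearOrder ι] [Fintype ι]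

/-- **Ruelle's cut over an arbitrary region, superselection form.** For Hermitian `A` in the even
CAR subalgebra of `S₁`, Hermitian `B` in the CAR subalgebra of a disjoint `S₂`, and a Hermitian `W` odd
under the regional parity `(-1)^{N_{S₁}}` (every hopping and pair term straddling the boundary of
`S₁`), `E₀(A + B + W) ≤ E₀(A) + E₀(B)`. [cite: Ruelle1969, §2.2] -/
theorem groundEnergy_add_add_le_of_straddling {S₁ S₂ : Finset ι} {A B W : Matrix (Finset ι) (Finset ι) ℂ}
    (hA : A ∈ carEvenSubalgebra S₁) (hB : B ∈ carSubalgebra S₂) (hS : Disjoint S₁ S₂)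
    (hAh : A.IsHermitian) (hBh : B.IsHermitian) (hWh : W.IsHermitian)
    (hW : regionParityOp S₁ * W * regionParityOp S₁ = -W) :
    (A + B + W).groundEnergy ≤ A.groundEnergy + B.groundEnergy := by
  rw [← groundEnergy_add_of_mem_carEvenSubalgebra hA hB hS hAh hBh]
  refine groundEnergy_add_le_of_grading (hAh.add hBh) hWh (regionParityOp_mul_self S₁)
    (regionParityOp_conjTranspose S₁) ?_ hW
  exact (commute_regionParityOp_of_mem_carEvenSubalgebra S₁ subset_rfl hA).add_right
    (commute_regionParityOp_of_mem_carSubalgebra S₁ hS hB)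

/-- The same with the straddling terms SUBTRACTED (the sign convention of hopping terms
`−t Σ c†c` and sources `−h(P + Pᴴ)`): `E₀(A + B − W) ≤ E₀(A) + E₀(B)`. [cite: Ruelle1969, §2.2] -/
theorem groundEnergy_add_sub_le_of_straddling {S₁ S₂ : Finset ι} {A B W : Matrix (Finset ι) (Finset ι) ℂ}
    (hA : A ∈ carEvenSubalgebra S₁) (hB : B ∈ carSubalgebra S₂) (hS : Disjoint S₁ S₂)
    (hAh : A.IsHermitian) (hBh : B.IsHermitian) (hWh : W.IsHermitian)
    (hW : regionParityOp S₁ * W * regionParityOp S₁ = -W) :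
    (A + B - W).groundEnergy ≤ A.groundEnergy + B.groundEnergy := by
  rw [sub_eq_add_neg]
  exact groundEnergy_add_add_le_of_straddling hA hB hS hAh hBh hWh.neg (regionParityOp_odd_neg hW)

end FermionCut

end Literature.MathematicalPhysics.QuantumLattice
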